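import Summits.CriticalPhenomena.PercolationContinuityZ3.Theorems.PercNearOneGluingNoHeavyQuantFarRingLeSix
import Summits.CriticalPhenomena.PercolationContinuityZ3.Theorems.PercNearOneGluingNoHeavyQuantFarHairyCycleLeSeven
import HarnessLib

/-!
# FAR beyond trees: `Quant.FarRelayRow` on every ring with ≤ 7 relays at cycle vertices and/or on pendant hairs

builds on p205010 (kernel theorem, internal audit signed; external expert review pending)

Support file (`--supports stmt-CriticalPhenomena-4575`), seat `prim-cert-1` (gen 18); sequel of `…QuantFarRingLeSix` (`K ≤ 6`) using the
`K = 7` sun certificates (`HairyCycle.farp_sun_seven`, `…QuantFarHairyCycleLeSeven`) through the degenerate-hair segment reduction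
`HairyCycle.farp_of_sunD`.  Result: `HairyCycle.farRelayRow_ring_le_seven` (data `HairyCycle.IsHairyCycleD`, `2 ≤ K ≤ 7`).
Computational by inheritance.  No sorries.
[cite: KozmaNitzan2024, Lemma 2 (p. 6), Conjecture 3 (p. 15)] (context: the lower-tail family; FAR is this programme's statement).
-/

noncomputable section

namespace Summit.CriticalPhenomena.PercolationContinuityZ3.Theorems.HairyCycle

open Finset MeasureTheory
open Literature.Probability.Percolation Literature.Probability.LatticeModels
open Summit.CriticalPhenomena.PercolationContinuityZ3.Theorems.AdditiveGluing.Negative.Cert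
open Summit.CriticalPhenomena.PercolationContinuityZ3.Theorems.TwoCopy
open scoped Classical

variable {n : ℕ} {L : ℕ} {cyc : ℕ → Fin n} {K : ℕ} {base : ℕ → ℕ} {tip : ℕ → Fin n}

/-- **`Quant.FarRelayRow` ON EVERY RING WITH AT MOST SEVEN RELAYS (at cycle vertices and/or pendant): for `IsHairyCycleD L cyc K base tip`
with `K ≤ 7`, every weight function supported on the cycle edges and the proper hair edges, every layer `j` and every `t`,
`2j < Σ_k P(c_0 ↔ t_k)` and `P(c_0 ↮ t_k) ≤ t` (all `k`) imply `P(#{k : c_0 ↔ t_k} ≤ j) ≤ t`.** [this work] -/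
theorem farRelayRow_ring_le_seven (H : IsHairyCycleD L cyc K base tip) (hK : K ≤ 7) (w : Sym2 (Fin n) → unitInterval)
    (hsupp : ∀ e : Sym2 (Fin n), ¬ e.IsDiag → w e ≠ 0 →
      (∃ i, i < L ∧ e = cycE L cyc i) ∨ (∃ k, k < K ∧ e = hairE cyc base tip k))
    (j : ℕ) (t : ℝ)
    (hEN : (2 * j : ℝ) < ∑ a ∈ (Finset.range K).image tip, (prodBernoulli w).real (openConn (cyc 0) a))
    (hcut : ∀ a ∈ (Finset.range K).image tip, (prodBernoulli w).real (openConn (cyc 0) a)ᶜ ≤ t) :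
    (prodBernoulli w).real {ω : BondConfig (Fin n) |
      (((Finset.range K).image tip).filter fun a => ω ∈ openConn (cyc 0) a).card ≤ j} ≤ t := by
  rcases Nat.lt_or_ge K 7 with h7 | h7
  · exact farRelayRow_ring_le_six H (by omega) w hsupp j t hEN hcut
  · have hK' : K = 7 := by omega
    subst hK'
    exact farp_of_sunD H j (farp_sun_seven j) w hsupp hEN t hcut

end Summit.CriticalPhenomena.PercolationContinuityZ3.Theorems.HairyCycle

end
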